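import Summits.ResolutionOfSingularities.ResolutionOfSingularities.Theorems.NearExitChart
import Summits.ResolutionOfSingularities.ResolutionOfSingularities.Theorems.MaxContactCutShallowCut

/-!
# Near exit — THE LETTER `VeryNearCutClasses.VeryNearExit`, hypothesis-free (campaign «NearExit», g33, file 12)

`veryNearExit_holds : VeryNearExit` — ZERO binders, verbatim on the landed definition
(`Theorems/VeryNearCutClasses.lean`), for EVERY point `x′` over `y` (closed or not) of EVERY blow-up `π : Y′ → Y` whose
centre has stalk `(c) = 𝔪_y` at `y`.

PROOF.  The tree's stalk dictionary `IsBlowup.exists_reesChart_stalk` presents `𝒪_{Y′,x′}` as the localisation of a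
Rees chart `S = 𝒪_{Y,y}[c/c_j]` at a prime `𝔴` over `𝔪_y` (`χ : S → 𝒪_{Y′,x′}`, `χ ∘ (𝒪_{Y,y} → S) = π^♯`); the stalk
of the controlled transform `J′ = (π^*J : 𝓘(E)ⁿ)` is the colon `(J𝒪_{x′} : σ(c_j)ⁿ)` (`stalkIdeal_colon`), it lies in
`𝔪_{x′}ⁿ` at a NEAR point (`le_idealOrder_iff`), and `τ(x′)` may be computed in any minimal basis of `𝔪_{x′}`
(`stalkTau_eq`).  The chart theorem `NearExit.two_le_tau_chart` then gives `τ(x′) ≥ 2`.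

COROLLARY (§2): the landed fourteen-engine corollary `ShallowCut.cuspGenericRung_of_engines` with the binder
`hV : VeryNearExit` removed BY NAME (thirteen engine binders left), and `MaxContactCut.RungOne` from those thirteen
engines and the located residual `CuspX.CuspSpecialRung` (`CuspX.closes`, cited).

Sources: [CossartPiltant2008] proof of Prop. 4.2 (a)(b), Lemma 4.3; [Hironaka1970] Thms. 2, 3; [StacksProject] Tags
0804, 0BIQ.
-/

open IsLocalRing
open Literature.AlgebraicGeometry.Resolution

namespace Summit.ResolutionOfSingularities.ResolutionOfSingularities.Theorems.NearExit

/-! ## §1  The letter -/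

section SchemeLevel

open CategoryTheory AlgebraicGeometry TopologicalSpace
open Summit.ResolutionOfSingularities.ResolutionOfSingularities.Theorems

/-- **THE ENGINE `VeryNearExit` HOLDS** — hypothesis-free: at a point `y` with regular local ring and minimal regular
system of parameters `c`, a near-generic face of `J_y` at order `n ≥ 2` forces `τ ≥ 2` at every near point of every
blow-up with centre stalk `(c)` at `y`. [cite: CossartPiltant2008, Prop. 4.2] [cite: Hironaka1970, Thms. 2, 3]
[cite: StacksProject, Tag 0804] -/
theorem veryNearExit_holds : VeryNearCutClasses.VeryNearExit := by
  intro Y J n hn y hRy d c hc hd hface Y' π Z hπ hNY hNY' hcC x' hx' hRx' hnear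
  subst hx'
  haveI := hRy
  haveI := hRx'
  haveI := hNY
  haveI := hNY'
  obtain ⟨j, 𝔴, χ, hχ, hloc, h𝔴⟩ := hπ.exists_reesChart_stalk x' c hcC
  haveI : 𝔴.asIdeal.IsPrime := 𝔴.isPrime
  -- the stalk of the controlled transform is the colon `(J𝒪_{x′} : σ(c_j)ⁿ)`
  have hu : ∀ l, (π.stalkMap x').hom (c l) = (π.stalkMap x').hom (c j) * χ (chartGen c j l) :=
    fun l => sigma_apply_eq c j (π.stalkMap x').hom χ hχ l
  have hCmap : (stalkIdeal (Scheme.IdealSheafData.vanishingIdeal Z) (π x')).map (π.stalkMap x').hom =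
      Ideal.span {(π.stalkMap x').hom (c j)} := by
    rw [← hcC, Ideal.map_span_range_eq_span_singleton _ _ j _ hu]
  have hJ' : stalkIdeal (controlledTransform π (Scheme.IdealSheafData.vanishingIdeal Z) J n) x' =
      Submodule.colon ((stalkIdeal J (π x')).map (π.stalkMap x').hom)
        ((Ideal.span {(π.stalkMap x').hom (c j)} ^ n : Ideal _) : Set _) := by
    rw [controlledTransform, stalkIdeal_colon, stalkIdeal_pow, stalkIdeal_comap_eq_map_stalkMap,
      stalkIdeal_comap_eq_map_stalkMap, hCmap]
  have hcol : ∀ h : Y'.presheaf.stalk x', (π.stalkMap x').hom (c j) ^ n * h ∈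
      (stalkIdeal J (π x')).map (π.stalkMap x').hom →
      h ∈ stalkIdeal (controlledTransform π (Scheme.IdealSheafData.vanishingIdeal Z) J n) x' := by
    intro h hh
    rw [hJ', Submodule.mem_colon]
    intro s hs
    rw [SetLike.mem_coe, Ideal.span_singleton_pow] at hs
    obtain ⟨a, rfl⟩ := Ideal.mem_span_singleton'.mp hs
    have e : h • (a * (π.stalkMap x').hom (c j) ^ n) = a * ((π.stalkMap x').hom (c j) ^ n * h) := by
      rw [smul_eq_mul]; ring
    rw [e]
    exact Ideal.mul_mem_left _ a hh
  -- a near point: `J′_{x′} ⊆ 𝔪_{x′}ⁿ`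
  have hord : idealOrder (controlledTransform π (Scheme.IdealSheafData.vanishingIdeal Z) J n) x' = n := hnear
  have hnear' : stalkIdeal (controlledTransform π (Scheme.IdealSheafData.vanishingIdeal Z) J n) x' ≤
      maximalIdeal (Y'.presheaf.stalk x') ^ n := (le_idealOrder_iff _ x' n).mp (le_of_eq hord.symm)
  -- `τ(x′)` in a minimal basis of `𝔪_{x′}`, and the chart theorem
  obtain ⟨x, hx⟩ := exists_regularSystemOfParameters (R := Y'.presheaf.stalk x')
  rw [stalkTau_eq _ x' n rfl x hx]
  exact two_le_tau_chart c hc hd (stalkIdeal J (π x')) hn hface j 𝔴.asIdeal h𝔴 (Y'.presheaf.stalk x')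
    (π.stalkMap x').hom χ hχ hloc _ hcol hnear' x hx

/-- The letter, verbatim, under its fully qualified name. -/
example : _root_.Summit.ResolutionOfSingularities.ResolutionOfSingularities.Theorems.VeryNearCutClasses.VeryNearExit :=
  veryNearExit_holds

end SchemeLevel

/-! ## §2  DISCHARGE COROLLARY: the landed fourteen-engine corollary `ShallowCut.cuspGenericRung_of_engines` with the
binder `hV : VeryNearExit` removed BY NAME (thirteen engine binders left) -/

section Corollaries

open Summit.ResolutionOfSingularities.ResolutionOfSingularities.Theorems
open Summit.ResolutionOfSingularities.ResolutionOfSingularities.Theorems.WeakOrderReduction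
open Summit.ResolutionOfSingularities.ResolutionOfSingularities.Theorems.DeltaFaceCutClasses
open Summit.ResolutionOfSingularities.ResolutionOfSingularities.Theorems.RelativeDeltaCut
open Summit.ResolutionOfSingularities.ResolutionOfSingularities.Theorems.FaceFormCutClasses
open Summit.ResolutionOfSingularities.ResolutionOfSingularities.Theorems.CurveLeafExit
open Summit.ResolutionOfSingularities.ResolutionOfSingularities.Theorems.PinchCut
open Summit.ResolutionOfSingularities.ResolutionOfSingularities.Theorems.JetCut
open Summit.ResolutionOfSingularities.ResolutionOfSingularities.Theorems.PurityCut
open Summit.ResolutionOfSingularities.ResolutionOfSingularities.Theorems.SplitCut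
open Summit.ResolutionOfSingularities.ResolutionOfSingularities.Theorems.CylinderCut
open Summit.ResolutionOfSingularities.ResolutionOfSingularities.Theorems.CrossCut
open Summit.ResolutionOfSingularities.ResolutionOfSingularities.Theorems.DeepCrossCut
open Summit.ResolutionOfSingularities.ResolutionOfSingularities.Theorems.OddCrossCut
open Summit.ResolutionOfSingularities.ResolutionOfSingularities.Theorems.CuspCut
open Summit.ResolutionOfSingularities.ResolutionOfSingularities.Theses

/-- **`CuspX.CuspGenericRung` from THIRTEEN engines**: `ShallowCut.cuspGenericRung_of_engines` with `hV` discharged by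
`veryNearExit_holds`. [folklore] -/
theorem cuspGenericRung_of_engines (hD : DeltaPackageExit) (hU : UniformCurvePackageExit) (hR : RelCurvePackageExit)
    (hGE : GrandExit) (hSE : SplitConeExit) (hJE : JetCylinderExit)
    (hX : MaxContactCut.MaxOrderThreefoldResolution) (hXE : CrossExit) (hDXE : DeepCrossExit) (hNE : NodeExit)
    (hOXE : OddCrossExit) (hCuE : CuspExit) (hTaE : TameTwoExit) : CuspX.CuspGenericRung :=
  ShallowCut.cuspGenericRung_of_engines veryNearExit_holds hD hU hR hGE hSE hJE hX hXE hDXE hNE hOXE hCuE hTaE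

/-- **`MaxContactCut.RungOne` BY NAME from thirteen engines and the located residual `CuspX.CuspSpecialRung`**
(`CuspX.closes`, cited, not re-landed). [folklore] -/
theorem closes_of_engines (hD : DeltaPackageExit) (hU : UniformCurvePackageExit) (hR : RelCurvePackageExit)
    (hGE : GrandExit) (hSE : SplitConeExit) (hJE : JetCylinderExit)
    (hX : MaxContactCut.MaxOrderThreefoldResolution) (hXE : CrossExit) (hDXE : DeepCrossExit) (hNE : NodeExit)
    (hOXE : OddCrossExit) (hCuE : CuspExit) (hTaE : TameTwoExit) (hS : CuspX.CuspSpecialRung) :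
    MaxContactCut.RungOne :=
  CuspX.closes (cuspGenericRung_of_engines hD hU hR hGE hSE hJE hX hXE hDXE hNE hOXE hCuE hTaE) hS

end Corollaries

end Summit.ResolutionOfSingularities.ResolutionOfSingularities.Theorems.NearExit
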